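/-
Copyright (c) 2026 the pub-hodgecm-mathlib formalisation cell (harness21).  Prover seat hodgecm-mathlib-K2E5-p17 (g9) (L1 hand dealt to S4 by chair VALVE 12 (c)),
R90-TF §S4 — FILE B, THE (U2-UPG) PAYER (S4 dealer K2E2-plan (g7) DEAL 2026-09-05T02:09:12Z (2)): the Borel ∕ everywhere-invariant upgrade of a character density on
`U(Φ₂)(L⁺_v)`.  THEOREMS ONLY (no `def`, no `instance`, no notation, no named-fact hypothesis, no `sorry`); NO `Lines` import.
-/
import Summits.HodgeConjecture.HodgeConjecture.Theorems.R90S4U2SingularNull          -- ★ FILE A (this seat): `isOpen_and_measure_compl_setOf_isRegularElt_u2Loc` (`G^{reg}` open and conull); brings ★ `K2E3CharLocIntOfLocal` (`setIntegral_eq_smoothTrace_indicator`), ★ `SmoothCharacterConjugation`, ★ `AEEqOfCompactOpenSetIntegral`, ★ `LocalUnitaryGroupCongrMeasure`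
import Literature.NumberTheory.Rogawski1990.LocalTransferFundamentalLemma              -- ★ `IsLocSmooth`
import HarnessLib

/-!
# R90-TF §S4 — (U2-UPG): THE BOREL ∕ EVERYWHERE-INVARIANT UPGRADE OF A CHARACTER DENSITY ON `U(Φ₂)(L⁺_v)` (Harish-Chandra 1970 Part V; 1999 Thm. 16.3, §21)

Cell `hodgecm-mathlib`, crux item h413 = `stmt-HodgeConjecture-24833` (helper lane `--supports … --as helper`, count-neutral); R90-TF squad S4 (dealer K2E2-plan
(g7) DEAL 2026-09-05T02:09:12Z (2), text `K2/K2E2-plan/g7/DEAL-p31-U1INV-p17-U2UPG.md`).  THE SOCKET: sub-sub-sub-socket (U2-UPG) `stub_R90_S4_U2_charInvUpgrade` of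
the S4 file B ED. 10 `Cruxes/H413/Lines/R90_S4_HPacketsU2B.lean` (5dfcca3e8f153637) :622–:643; **`u2_charInvUpgrade`** below has that ∀-body as its TYPE, with the
`abbrev U2Loc L v` spelled as its body `(cmDatum L 2 Φ₂).Local v` (no `Lines` import here), so the typist pays the socket by `exact`.

THE MATHEMATICS.  `G = U(Φ₂)(L⁺_v)`, `μ` a Haar measure, `π` an ADMISSIBLE irreducible smooth class, `Θ ∈ L¹_loc(μ)` locally constant on the regular set `G^{reg}`
with `Tr π(f) = ∫ f Θ dμ` for all `f ∈ 𝒮(G)`.  (1) `G^{reg}` is OPEN and CONULL (★ FILE A `isOpen_and_measure_compl_setOf_isRegularElt_u2Loc`: Harish-Chandra's Lemma 42 for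
`U(Φ₂)_v` at every finite place).  (2) For `x ∈ G`, `Θ ∘ Ad(x)` ALSO represents `Tr π` on `𝒮(G)` (★ `IrrClass.smoothTrace_eq_integral_comp_conj`: the character of an
admissible class is `Ad`-invariant up to the Haar constant of `Ad(x)`, ★ `exists_map_eq_smul_of_continuousMulEquiv`), so `Θ = Θ ∘ Ad(x)` `μ`-a.e. ON `G^{reg}` (both integrate
every compact open `C` to `Tr π(𝟙_C)`, ★ `setIntegral_eq_smoothTrace_indicator`, and a density is determined a.e. by these integrals, ★
`ae_eq_restrict_of_forall_setIntegral_eq_of_isCompact_isOpen`).  (3) UPGRADE: on the open `G^{reg}` both `Θ` and `Θ ∘ Ad(x)` are continuous (locally constant; `Ad(x)`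
preserves `G^{reg}`, ★ `isRegularElt_conj_iff`), so `{z ∈ G^{reg} | Θ z ≠ Θ(x z x⁻¹)}` is OPEN and NULL, hence EMPTY (a Haar measure charges every non-empty open set).
(4) `Θ′ := 𝟙_{G^{reg}} · Θ` is Borel (continuous on the open `G^{reg}`, `0` on the closed complement), `L¹_loc`, EVERYWHERE `Ad`-invariant by (3), and `= Θ` a.e. by (1),
so it represents `Tr π` on `C_c^∞(G) = 𝒮(G)` (★ `IsLocSmooth` = locally constant with compact support = membership in ★ `SchwartzBruhat`).
HONEST LABEL.  Count-neutral helper: `HC_CM` is proved only modulo the 7 printed citations (2 remaining named inputs: hLiu418 = `stmt-HodgeConjecture-24832`,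
h413 = `stmt-HodgeConjecture-24833`) until rung 0 closes; (U2-UPG) is one of the four sub-sockets of (HC-LI) ((U2-HC) = the E3 junction, OPEN over (res-ω-CI);
(U1-INV), (PROD) dealt to other hands); paying it closes no named input by itself.
-/

set_option autoImplicit false
set_option linter.dupNamespace false -- the mandated namespace repeats `HodgeConjecture.HodgeConjecture`

noncomputable section

open NumberField IsDedekindDomain MeasureTheory TopologicalSpace Filter
open scoped Matrix MatrixGroups NNReal ENNReal Topology
open Literature.NumberTheory.Rogawski1990 Literature.NumberTheory.Automorphic Literature.NumberTheory.Automorphic.UnitaryGroup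
open Literature.MeasureTheory.Function
open Summit.HodgeConjecture.HodgeConjecture.Cruxes.H413

namespace Summit.HodgeConjecture.HodgeConjecture.R90.S4

/-- **(U2-UPG) — THE BOREL ∕ EVERYWHERE-INVARIANT UPGRADE ON `U(Φ₂)_v`** (the ∀-body of `stub_R90_S4_U2_charInvUpgrade`, B ED. 10 :622–:643, `U2Loc` unfolded): for a Haar
measure `μ` on `G = U(Φ₂)(L⁺_v)` and an ADMISSIBLE class `π`, a density `Θ ∈ L¹_loc(μ)`, locally constant on `G^{reg}`, representing `Tr π` on `𝒮(G)` can be replaced by a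
BOREL, EVERYWHERE conjugation-invariant `Θ′ ∈ L¹_loc(μ)` representing `Tr π` on `C_c^∞(G)`: `Θ′ := 𝟙_{G^{reg}} · Θ` (module docstring (1)–(4)).
[cite: HarishChandra1970, Part V Lemma 42] [cite: HarishChandra1999, Thm. 16.3 p. 77; §21 p. 87] [cite: Rogawski1990, §1.6 pp. 5–6; §3.1 p. 19; §12.5 p. 182] -/
theorem u2_charInvUpgrade :
    ∀ (L : Type) [Field L] [NumberField L] [IsCMField L] (v : HeightOneSpectrum (𝓞 ↥(maximalRealSubfield L)))
      [MeasurableSpace ((cmDatum L 2 (Matrix.of fun i j : Fin 2 => if i.val + j.val + 1 = 2 then (1 : L) else 0)).Local v)]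
      [BorelSpace ((cmDatum L 2 (Matrix.of fun i j : Fin 2 => if i.val + j.val + 1 = 2 then (1 : L) else 0)).Local v)]
      (μ : MeasureTheory.Measure ((cmDatum L 2 (Matrix.of fun i j : Fin 2 => if i.val + j.val + 1 = 2 then (1 : L) else 0)).Local v)) [μ.IsHaarMeasure]
      (π : IrrClass ((cmDatum L 2 (Matrix.of fun i j : Fin 2 => if i.val + j.val + 1 = 2 then (1 : L) else 0)).Local v)), π.IsAdmissible →
      (∃ Θ : (cmDatum L 2 (Matrix.of fun i j : Fin 2 => if i.val + j.val + 1 = 2 then (1 : L) else 0)).Local v → ℂ,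
        MeasureTheory.LocallyIntegrable Θ μ ∧
        IsLocallyConstant
          (fun g : {g : (cmDatum L 2 (Matrix.of fun i j : Fin 2 => if i.val + j.val + 1 = 2 then (1 : L) else 0)).Local v //
            Literature.NumberTheory.Rogawski1990.IsRegularElt (g.1 : GL (Fin 2) (LocalRing L v))} => Θ g.1) ∧
        ∀ f : (cmDatum L 2 (Matrix.of fun i j : Fin 2 => if i.val + j.val + 1 = 2 then (1 : L) else 0)).Local v → ℂ,
          f ∈ SchwartzBruhat ((cmDatum L 2 (Matrix.of fun i j : Fin 2 => if i.val + j.val + 1 = 2 then (1 : L) else 0)).Local v) →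
          π.smoothTrace μ f = MeasureTheory.integral μ (fun g => f g * Θ g)) →
      ∃ Θ : (cmDatum L 2 (Matrix.of fun i j : Fin 2 => if i.val + j.val + 1 = 2 then (1 : L) else 0)).Local v → ℂ,
        MeasureTheory.LocallyIntegrable Θ μ ∧ Measurable Θ ∧
        (∀ x g : (cmDatum L 2 (Matrix.of fun i j : Fin 2 => if i.val + j.val + 1 = 2 then (1 : L) else 0)).Local v, Θ (x * g * x⁻¹) = Θ g) ∧
        ∀ f : (cmDatum L 2 (Matrix.of fun i j : Fin 2 => if i.val + j.val + 1 = 2 then (1 : L) else 0)).Local v → ℂ,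
          Literature.NumberTheory.Rogawski1990.IsLocSmooth f →
          π.smoothTrace μ f = MeasureTheory.integral μ (fun g => f g * Θ g) := by
  intro L _ _ _ v _ _ μ _ π hadm hΘ
  obtain ⟨Θ, hli, hlc, hrep⟩ := hΘ
  haveI : NonarchimedeanGroup ((cmDatum L 2 (Matrix.of fun i j : Fin 2 => if i.val + j.val + 1 = 2 then (1 : L) else 0)).Local v) :=
    nonarchimedeanGroup_unitaryGroupOfForm_local L (IsCMField.complexConj L) 2 v _
  -- (1) the regular set: open and conull (★ FILE A)
  obtain ⟨hRo, hRc⟩ := isOpen_and_measure_compl_setOf_isRegularElt_u2Loc L v μ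
  set R : Set ((cmDatum L 2 (Matrix.of fun i j : Fin 2 => if i.val + j.val + 1 = 2 then (1 : L) else 0)).Local v) :=
    {g | IsRegularElt (g.val : GL (Fin 2) (UnitaryGroup.LocalRing L v))} with hR
  have hlev : ∀ f : (cmDatum L 2 (Matrix.of fun i j : Fin 2 => if i.val + j.val + 1 = 2 then (1 : L) else 0)).Local v → ℂ,
      f ∈ SchwartzBruhat ((cmDatum L 2 (Matrix.of fun i j : Fin 2 => if i.val + j.val + 1 = 2 then (1 : L) else 0)).Local v) →
      ∃ K : Subgroup ((cmDatum L 2 (Matrix.of fun i j : Fin 2 => if i.val + j.val + 1 = 2 then (1 : L) else 0)).Local v), IsLevel K f :=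
    fun f hf => exists_isLevel hf
  have hΘcont : ContinuousOn Θ R := by
    rw [continuousOn_iff_continuous_restrict]
    exact hlc.continuous
  have hAd : ∀ x : (cmDatum L 2 (Matrix.of fun i j : Fin 2 => if i.val + j.val + 1 = 2 then (1 : L) else 0)).Local v,
      Continuous fun z : (cmDatum L 2 (Matrix.of fun i j : Fin 2 => if i.val + j.val + 1 = 2 then (1 : L) else 0)).Local v => x * z * x⁻¹ :=
    fun x => (continuous_const.mul continuous_id).mul continuous_const
  have hAdR : ∀ x z : (cmDatum L 2 (Matrix.of fun i j : Fin 2 => if i.val + j.val + 1 = 2 then (1 : L) else 0)).Local v, x * z * x⁻¹ ∈ R ↔ z ∈ R :=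
    fun x z => isRegularElt_conj_iff (x.val : GL (Fin 2) (UnitaryGroup.LocalRing L v)) (z.val : GL (Fin 2) (UnitaryGroup.LocalRing L v))
  -- (2)+(3) `Θ ∘ Ad(x) = Θ` EVERYWHERE on the regular set
  have key : ∀ x : (cmDatum L 2 (Matrix.of fun i j : Fin 2 => if i.val + j.val + 1 = 2 then (1 : L) else 0)).Local v, ∀ z ∈ R, Θ (x * z * x⁻¹) = Θ z := by
    intro x
    -- the Haar constants of `Ad(x⁻¹)` and `Ad(x)`
    let ψ : (cmDatum L 2 (Matrix.of fun i j : Fin 2 => if i.val + j.val + 1 = 2 then (1 : L) else 0)).Local v ≃ₜ*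
        (cmDatum L 2 (Matrix.of fun i j : Fin 2 => if i.val + j.val + 1 = 2 then (1 : L) else 0)).Local v :=
      ContinuousMulEquiv.mk' ((Homeomorph.mulLeft x⁻¹).trans (Homeomorph.mulRight x)) fun a b => by
        show x⁻¹ * (a * b) * x = x⁻¹ * a * x * (x⁻¹ * b * x)
        group
    let φ : (cmDatum L 2 (Matrix.of fun i j : Fin 2 => if i.val + j.val + 1 = 2 then (1 : L) else 0)).Local v ≃ₜ*
        (cmDatum L 2 (Matrix.of fun i j : Fin 2 => if i.val + j.val + 1 = 2 then (1 : L) else 0)).Local v :=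
      ContinuousMulEquiv.mk' ((Homeomorph.mulLeft x).trans (Homeomorph.mulRight x⁻¹)) fun a b => by
        show x * (a * b) * x⁻¹ = x * a * x⁻¹ * (x * b * x⁻¹)
        group
    obtain ⟨a, ha0, haμ⟩ := exists_map_eq_smul_of_continuousMulEquiv ψ μ μ
    obtain ⟨b, hb0, hbμ⟩ := exists_map_eq_smul_of_continuousMulEquiv φ μ μ
    have hψ : (ψ : (cmDatum L 2 (Matrix.of fun i j : Fin 2 => if i.val + j.val + 1 = 2 then (1 : L) else 0)).Local v →
        (cmDatum L 2 (Matrix.of fun i j : Fin 2 => if i.val + j.val + 1 = 2 then (1 : L) else 0)).Local v) = fun z => x⁻¹ * z * x := rfl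
    have hφ : (φ : (cmDatum L 2 (Matrix.of fun i j : Fin 2 => if i.val + j.val + 1 = 2 then (1 : L) else 0)).Local v →
        (cmDatum L 2 (Matrix.of fun i j : Fin 2 => if i.val + j.val + 1 = 2 then (1 : L) else 0)).Local v) = fun z => x * z * x⁻¹ := rfl
    rw [hψ, ENNReal.smul_def] at haμ
    rw [hφ, ENNReal.smul_def] at hbμ
    -- `Θ ∘ Ad(x)` represents `Tr π` on every test function
    have hrepx : ∀ f : (cmDatum L 2 (Matrix.of fun i j : Fin 2 => if i.val + j.val + 1 = 2 then (1 : L) else 0)).Local v → ℂ,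
        f ∈ SchwartzBruhat ((cmDatum L 2 (Matrix.of fun i j : Fin 2 => if i.val + j.val + 1 = 2 then (1 : L) else 0)).Local v) →
        π.smoothTrace μ f = ∫ z, f z * Θ (x * z * x⁻¹) ∂μ := fun f hf =>
      IrrClass.smoothTrace_eq_integral_comp_conj μ π hadm hlev x (U := Set.univ) (Θ := Θ) (fun f hf _ => hrep f hf)
        (ENNReal.coe_ne_zero.2 ha0.ne') ENNReal.coe_ne_top haμ hf (fun z _ => Set.mem_univ _)
    -- a.e. on the (open) regular set: both densities integrate every compact open `C` to `Tr π(𝟙_C)`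
    have hae : ∀ᵐ z ∂μ.restrict R, Θ z = Θ (x * z * x⁻¹) := by
      refine ae_eq_restrict_of_forall_setIntegral_eq_of_isCompact_isOpen isTopologicalBasis_setOf_isCompact_isOpen μ hRo
        (fun C _ hCc _ => hli.integrableOn_isCompact hCc) (fun C _ hCc _ => ?_) (fun C _ hCc hCo => ?_)
      · have h1 : IntegrableOn Θ ((fun z => x * z * x⁻¹) '' C) μ := hli.integrableOn_isCompact (hCc.image (hAd x))
        exact (integrableOn_comp_conj_preimage μ h1 x ENNReal.coe_ne_top hbμ).mono_set (Set.subset_preimage_image _ _)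
      · rw [K2E3CharLocIntOfLocal.setIntegral_eq_smoothTrace_indicator μ π (O := Set.univ) (fun f hf _ => hrep f hf) ⟨hCc.isClosed, hCo⟩ hCc
            (Set.subset_univ _),
          K2E3CharLocIntOfLocal.setIntegral_eq_smoothTrace_indicator μ π (O := Set.univ) (Θ := fun z => Θ (x * z * x⁻¹)) (fun f hf _ => hrepx f hf)
            ⟨hCc.isClosed, hCo⟩ hCc (Set.subset_univ _)]
    -- upgrade: the exceptional set is open (both sides continuous on the open `R`) and null, hence empty
    have hcont2 : ContinuousOn (fun z => (Θ z, Θ (x * z * x⁻¹))) R :=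
      hΘcont.prodMk (hΘcont.comp (hAd x).continuousOn fun z hz => (hAdR x z).2 hz)
    have hDo : IsOpen (R ∩ (fun z => (Θ z, Θ (x * z * x⁻¹))) ⁻¹' (Set.diagonal ℂ)ᶜ) :=
      hcont2.isOpen_inter_preimage hRo isClosed_diagonal.isOpen_compl
    have hDnull : μ (R ∩ (fun z => (Θ z, Θ (x * z * x⁻¹))) ⁻¹' (Set.diagonal ℂ)ᶜ) = 0 := by
      have h1 : ∀ᵐ z ∂μ, z ∈ R → Θ z = Θ (x * z * x⁻¹) := (ae_restrict_iff' hRo.measurableSet).1 hae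
      rw [measure_eq_zero_iff_ae_notMem]
      filter_upwards [h1] with z hz
      rintro ⟨hzR, hne⟩
      exact hne (hz hzR)
    have hDempty : R ∩ (fun z => (Θ z, Θ (x * z * x⁻¹))) ⁻¹' (Set.diagonal ℂ)ᶜ = ∅ := (hDo.measure_eq_zero_iff μ).1 hDnull
    intro z hz
    by_contra hne
    have hmem : z ∈ R ∩ (fun z => (Θ z, Θ (x * z * x⁻¹))) ⁻¹' (Set.diagonal ℂ)ᶜ := ⟨hz, fun h => hne (Eq.symm h)⟩
    rw [hDempty] at hmem
    exact hmem
  -- (4) the Borel, everywhere-invariant representative `Θ′ := 𝟙_{G^{reg}} · Θ`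
  refine ⟨R.indicator Θ, hli.indicator hRo.measurableSet, ?_, ?_, ?_⟩
  · -- Borel: continuous on the open `R`, zero on its complement
    refine measurable_of_restrict_of_restrict_compl hRo.measurableSet ?_ ?_
    · have h1 : R.restrict (R.indicator Θ) = fun g : R => Θ g.1 := by
        funext g
        exact Set.indicator_of_mem g.2 Θ
      rw [h1]
      exact hlc.continuous.measurable
    · have h2 : Rᶜ.restrict (R.indicator Θ) = fun _ => 0 := by
        funext g
        exact Set.indicator_of_notMem g.2 Θ
      rw [h2]
      exact measurable_const
  · -- everywhere `Ad`-invariant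
    intro x g
    by_cases hg : g ∈ R
    · rw [Set.indicator_of_mem hg, Set.indicator_of_mem ((hAdR x g).2 hg), key x g hg]
    · rw [Set.indicator_of_notMem hg, Set.indicator_of_notMem (fun h => hg ((hAdR x g).1 h))]
  · -- represents `Tr π` on `C_c^∞(G)`: `Θ′ = Θ` a.e. (the singular set is null)
    intro f hf
    have hf' : f ∈ SchwartzBruhat ((cmDatum L 2 (Matrix.of fun i j : Fin 2 => if i.val + j.val + 1 = 2 then (1 : L) else 0)).Local v) := hf
    rw [hrep f hf']
    refine integral_congr_ae ?_
    have h1 : ∀ᵐ z ∂μ, z ∉ Rᶜ := measure_eq_zero_iff_ae_notMem.1 hRc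
    filter_upwards [h1] with z hz
    rw [Set.indicator_of_mem (Set.not_notMem.1 hz)]

end Summit.HodgeConjecture.HodgeConjecture.R90.S4

end
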